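import Summits.NavierStokesRegularity.NavierStokesRegularity.Theorems.GaldiLiouvilleGateRecordZoomAncientKernelIffFCV
import HarnessLib

/-!
# Route `GaldiLiouvilleGate`, crux `RecordZoomAncient` (stmt-NavierStokesRegularity-0894),
  line `registered` — PROVED RUNGS of "no faint blow-up" (FCV), per solution

`u` is a classical Navier–Stokes solution on `ℝ³ × [0, T)`, Leray–Hopf from the rapidly decaying
`u 0`, with no smooth extension past `T`; `E(s) = ∫⁻ |∇u(s)|²`; a level `L > 0` DOMINATES at `t`
if `E ≤ L` on `[0, t]`. FREQUENT CRITICAL VELOCITY for `u` (the conclusion of FCV, the open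
content of the crux — see `GaldiLiouvilleGateRecordZoomAncientKernelIffFCV.lean`) is

  `∃ θ > 0, ∀ t' ∈ [0, T), ∃ t ∈ [t', T), ∃ x, ∃ L > 0, (E ≤ L on [0, t]) ∧ θ L/ν ≤ ‖u(t, x)‖`.

This file records, as named theorems about ONE solution, the three scenarios in which the landed
branches of the line already give it (each: branch stub ⇒ velocity-concentrated zooms ⇒
`exists_criticalVelocity_of_concentratedZooms`):

* `exists_frequentCriticalVelocity_of_typeIEnstrophy` — TYPE-I ENSTROPHY ALONG A SEQUENCE: for
  some `C > 0`, arbitrarily close to `T` there are times `t` with `E ≤ C ν^{3/2}/√(T−t)` on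
  `[0, t]` (Leray's `L^∞` rate `leray_blowup_rate_top_holds` + `stub_typeIBranch`).
* `exists_frequentCriticalVelocity_of_fastDoubling` — FAST DOUBLING AT SOME SCALE: for some
  `K > 0`, arbitrarily close to `T` the enstrophy doubles (`E(t₁) ≤ L`, `E(t₂) ≥ 2L`, `E ≤ 2L` on
  `[0, t₂]`) within `< K ν³/L²` (`stub_fastBranch`, Serrin's endpoint enstrophy inequality).
* `exists_frequentCriticalVelocity_of_enstrophyConcentration` — ENSTROPHY CONCENTRATION AT THE
  CRITICAL SCALE: for some `R, ε > 0`, arbitrarily close to `T` some ball of radius `R ν²/L`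
  (`L` dominating at `t ≥ 3ν³/L²`) carries `≥ ε L` of `E(t)` (`stub_enstrophyConcentrationBranch`
  with the uniform `C^{1,κ}` bounds `stub_zoomC1kappa stub_oseenC1kappa` over `stub_zoomBound`).

What is NOT covered (the open kernel): blow-ups that are Type-II in enstrophy, eventually slowly
doubling at every scale and vanishing at the critical scale — equivalently FAINT
(`sup_{[0,t]} E/(ν ‖u(t)‖_∞) → ∞`).
-/

noncomputable section

open Set MeasureTheory Filter Topology Function
open scoped ENNReal NNReal
open Literature.Analysis.FluidPDE

namespace Summit.NavierStokesRegularity.NavierStokesRegularity.Theorems.RecordZoomAncient.Birth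

-- the problem-side namespace `Summit.NavierStokesRegularity.NavierStokesRegularity.…` (summit =
-- problem for this single-problem summit) duplicates `NavierStokesRegularity` by design
set_option linter.dupNamespace false

/-- **Leray's `L^∞` blow-up rate, pointwise form.** For a classical solution on `[0, T)`,
Leray–Hopf, Tao-class on every `[0, T']` (`T' < T`), with no smooth extension past `T`: there is
`c > 0` with, at every `t ∈ [0, T)`, a point `x` where `‖u(t, x)‖ ≥ c √ν/√(T−t)` (tree theorem
`leray_blowup_rate_top_holds`, its strip-boundedness hypothesis read off the representation, and
`exists_half_le_norm_of_ofReal_le_eLpNorm_top`). -/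
theorem exists_leray_rate_pointwise {ν T : ℝ} (hν : 0 < ν) (hT : 0 < T)
    {u : ℝ → EuclideanSpace ℝ (Fin 3) → EuclideanSpace ℝ (Fin 3)} {p : ℝ → EuclideanSpace ℝ (Fin 3) → ℝ}
    (hcl : IsClassicalNSSolutionOn (Set.Ico 0 T) ν 0 u p) (hLH : IsLerayHopfOn T ν 0 (u 0) u)
    (hrep : ∀ T' ∈ Set.Ioo 0 T, ∃ P : ℝ → EuclideanSpace ℝ (Fin 3) → ℝ, IsTaoSolutionOn T' ν (u 0) u P)
    (hnext : ¬ HasSmoothExtensionPast ν 0 u T) :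
    ∃ c : ℝ, 0 < c ∧ ∀ t ∈ Set.Ico 0 T, ∃ x, c * Real.sqrt ν / Real.sqrt (T - t) ≤ ‖u t x‖ := by
  obtain ⟨cL, hcL, hLer⟩ := leray_blowup_rate_top_holds
  have hstrip : ∀ T' ∈ Set.Ioo 0 T,
      eLpNorm (uncurry u) ∞ (volume.restrict (Set.Icc 0 T' ×ˢ univ)) < ∞ := by
    intro T' hT'
    obtain ⟨P, hP⟩ := hrep T' hT'
    obtain ⟨B, -, hB⟩ := hP.exists_bound_velocity
    rw [eLpNorm_exponent_top]
    refine eLpNormEssSup_lt_top_of_ae_bound (C := B) ?_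
    filter_upwards [ae_restrict_mem (measurableSet_Icc.prod MeasurableSet.univ)] with w hw
    obtain ⟨t, x⟩ := w
    exact hB t hw.1 x
  refine ⟨cL / 2, by positivity, fun t ht => ?_⟩
  have h := hLer ν T hν hT u p ⟨hcl, hnext⟩ hLH hstrip t ht
  have ha : 0 < cL * Real.sqrt ν / Real.sqrt (T - t) := by
    have h1 : 0 < Real.sqrt ν := Real.sqrt_pos.2 hν
    have h2 : 0 < Real.sqrt (T - t) := Real.sqrt_pos.2 (sub_pos.2 ht.2)
    positivity
  obtain ⟨x, hx⟩ := exists_half_le_norm_of_ofReal_le_eLpNorm_top ha h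
  refine ⟨x, ?_⟩
  have heq : cL / 2 * Real.sqrt ν / Real.sqrt (T - t) = cL * Real.sqrt ν / Real.sqrt (T - t) / 2 := by ring
  rw [heq]
  exact hx

/-- **Rung 1: Type-I enstrophy along a sequence gives frequent critical velocity.** If for some
`C > 0`, for every `t' < T` there is `t ∈ [t', T)` with `E(s) ≤ C ν^{3/2}/√(T−t)` for all
`s ∈ [0, t]`, then `u` has frequent critical velocity. Proof: representation (`stub_taoRep`),
persistence (`stub_enstrophyPersistence`), Leray's rate (`exists_leray_rate_pointwise`),
`stub_typeIBranch`, `exists_criticalVelocity_of_concentratedZooms`. -/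
theorem exists_frequentCriticalVelocity_of_typeIEnstrophy :
    ∀ (ν T : ℝ), 0 < ν → 0 < T →
      ∀ (u : ℝ → EuclideanSpace ℝ (Fin 3) → EuclideanSpace ℝ (Fin 3)) (p : ℝ → EuclideanSpace ℝ (Fin 3) → ℝ),
        IsClassicalNSSolutionOn (Set.Ico 0 T) ν 0 u p → IsLerayHopfOn T ν 0 (u 0) u →
        HasRapidSpatialDecay (u 0) → ¬ HasSmoothExtensionPast ν 0 u T →
        ∀ C : ℝ, 0 < C →
          (∀ t' ∈ Set.Ico 0 T, ∃ t ∈ Set.Ico t' T, ∀ s ∈ Set.Icc 0 t,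
            (∫⁻ x, ENNReal.ofReal (frobeniusNormSq (fderiv ℝ (u s) x))) ≤
              ENNReal.ofReal (C * (ν * Real.sqrt ν) / Real.sqrt (T - t))) →
        ∃ θ : ℝ, 0 < θ ∧ ∀ t' ∈ Set.Ico 0 T, ∃ t ∈ Set.Ico t' T,
          ∃ x : EuclideanSpace ℝ (Fin 3), ∃ L : ℝ, 0 < L ∧
            (∀ s ∈ Set.Icc 0 t,
              (∫⁻ x, ENNReal.ofReal (frobeniusNormSq (fderiv ℝ (u s) x))) ≤ ENNReal.ofReal L) ∧
            θ * L / ν ≤ ‖u t x‖ := by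
  intro ν T hν hT u p hcl hLH hdec hnext C hC hI
  have hrep : ∀ T' ∈ Set.Ioo 0 T, ∃ P : ℝ → EuclideanSpace ℝ (Fin 3) → ℝ, IsTaoSolutionOn T' ν (u 0) u P :=
    stub_taoRep ν T hν hT u p hcl hLH hdec
  obtain ⟨cP, K, hcP, hK, hpers⟩ := stub_enstrophyPersistence
  have hpers' := hpers ν T hν hT u p hcl hrep
  obtain ⟨cL, hcL, hrate⟩ := exists_leray_rate_pointwise hν hT hcl hLH hrep hnext
  obtain ⟨tc, xc, L, s₀, θ, hs₀, hθ, htc, hL, hdom, hpast, hconc⟩ :=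
    stub_typeIBranch ν T hν hT u p hcl cL hcL hrate cP K hcP hK hpers' C hC hI
  exact ⟨θ, hθ, exists_criticalVelocity_of_concentratedZooms hν hT hrep hs₀ hθ htc hL hdom hpast hconc⟩

/-- **Rung 2: fast doubling at some scale gives frequent critical velocity.** If for some
`K > 0`, for every `t' < T` there are `t' ≤ t₁ < t₂ < T` and `L > 0` with `E ≤ 2L` on `[0, t₂]`,
`E(t₁) ≤ L`, `E(t₂) ≥ 2L` and `t₂ − t₁ < K ν³/L²`, then `u` has frequent critical velocity.
Proof: `stub_fastBranch` (Serrin's endpoint enstrophy inequality) and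
`exists_criticalVelocity_of_concentratedZooms`. -/
theorem exists_frequentCriticalVelocity_of_fastDoubling :
    ∀ (ν T : ℝ), 0 < ν → 0 < T →
      ∀ (u : ℝ → EuclideanSpace ℝ (Fin 3) → EuclideanSpace ℝ (Fin 3)) (p : ℝ → EuclideanSpace ℝ (Fin 3) → ℝ),
        IsClassicalNSSolutionOn (Set.Ico 0 T) ν 0 u p → IsLerayHopfOn T ν 0 (u 0) u →
        HasRapidSpatialDecay (u 0) → ¬ HasSmoothExtensionPast ν 0 u T →
        ∀ K₀ : ℝ, 0 < K₀ →
          (∀ t' ∈ Set.Ico 0 T, ∃ t₁ ∈ Set.Ico t' T, ∃ t₂ ∈ Set.Ioo t₁ T, ∃ L : ℝ, 0 < L ∧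
            (∀ s ∈ Set.Icc 0 t₂,
              (∫⁻ x, ENNReal.ofReal (frobeniusNormSq (fderiv ℝ (u s) x))) ≤ ENNReal.ofReal (2 * L)) ∧
            (∫⁻ x, ENNReal.ofReal (frobeniusNormSq (fderiv ℝ (u t₁) x))) ≤ ENNReal.ofReal L ∧
            ENNReal.ofReal (2 * L) ≤ (∫⁻ x, ENNReal.ofReal (frobeniusNormSq (fderiv ℝ (u t₂) x))) ∧
            t₂ - t₁ < K₀ * ν ^ 3 / L ^ 2) →
        ∃ θ : ℝ, 0 < θ ∧ ∀ t' ∈ Set.Ico 0 T, ∃ t ∈ Set.Ico t' T,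
          ∃ x : EuclideanSpace ℝ (Fin 3), ∃ L : ℝ, 0 < L ∧
            (∀ s ∈ Set.Icc 0 t,
              (∫⁻ x, ENNReal.ofReal (frobeniusNormSq (fderiv ℝ (u s) x))) ≤ ENNReal.ofReal L) ∧
            θ * L / ν ≤ ‖u t x‖ := by
  intro ν T hν hT u p hcl hLH hdec hnext K₀ hK₀ hFD
  have hrep : ∀ T' ∈ Set.Ioo 0 T, ∃ P : ℝ → EuclideanSpace ℝ (Fin 3) → ℝ, IsTaoSolutionOn T' ν (u 0) u P :=
    stub_taoRep ν T hν hT u p hcl hLH hdec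
  obtain ⟨cP, K, hcP, hK, hpers⟩ := stub_enstrophyPersistence
  have hpers' := hpers ν T hν hT u p hcl hrep
  obtain ⟨tc, xc, L, s₀, θ, hs₀, hθ, htc, hL, hdom, hpast, hconc⟩ :=
    stub_fastBranch ν T hν hT u p hcl hLH hrep hnext cP K hcP hK hpers' K₀ hK₀ hFD
  exact ⟨θ, hθ, exists_criticalVelocity_of_concentratedZooms hν hT hrep hs₀ hθ htc hL hdom hpast hconc⟩

/-- **Rung 3: enstrophy concentration at the critical scale gives frequent critical velocity.**
If for some `R, ε > 0`, for every `t' < T` there are `t ∈ [t', T)`, a level `L > 0` dominating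
`E` on `[0, t]` with `t ≥ 3ν³/L²`, and a ball of radius `R ν²/L` carrying `≥ ε L` of `E(t)`,
then `u` has frequent critical velocity. Proof: the universal bound `stub_zoomBound`, the
uniform `C^{1,κ}` constants `stub_zoomC1kappa stub_oseenC1kappa`,
`stub_enstrophyConcentrationBranch`, `exists_criticalVelocity_of_concentratedZooms`. -/
theorem exists_frequentCriticalVelocity_of_enstrophyConcentration :
    ∀ (ν T : ℝ), 0 < ν → 0 < T →
      ∀ (u : ℝ → EuclideanSpace ℝ (Fin 3) → EuclideanSpace ℝ (Fin 3)) (p : ℝ → EuclideanSpace ℝ (Fin 3) → ℝ),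
        IsClassicalNSSolutionOn (Set.Ico 0 T) ν 0 u p → IsLerayHopfOn T ν 0 (u 0) u →
        HasRapidSpatialDecay (u 0) → ¬ HasSmoothExtensionPast ν 0 u T →
        ∀ R ε : ℝ, 0 < R → 0 < ε →
          (∀ t' ∈ Set.Ico 0 T, ∃ t ∈ Set.Ico t' T, ∃ x : EuclideanSpace ℝ (Fin 3), ∃ L : ℝ, 0 < L ∧
            (∀ s ∈ Set.Icc 0 t,
              (∫⁻ x, ENNReal.ofReal (frobeniusNormSq (fderiv ℝ (u s) x))) ≤ ENNReal.ofReal L) ∧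
            3 * ν ^ 3 / L ^ 2 ≤ t ∧
            ENNReal.ofReal (ε * L) ≤
              ∫⁻ y in Metric.ball x (R * ν ^ 2 / L), ENNReal.ofReal (frobeniusNormSq (fderiv ℝ (u t) y))) →
        ∃ θ : ℝ, 0 < θ ∧ ∀ t' ∈ Set.Ico 0 T, ∃ t ∈ Set.Ico t' T,
          ∃ x : EuclideanSpace ℝ (Fin 3), ∃ L : ℝ, 0 < L ∧
            (∀ s ∈ Set.Icc 0 t,
              (∫⁻ x, ENNReal.ofReal (frobeniusNormSq (fderiv ℝ (u s) x))) ≤ ENNReal.ofReal L) ∧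
            θ * L / ν ≤ ‖u t x‖ := by
  intro ν T hν hT u p hcl hLH hdec hnext R ε hR hε hEC
  have hrep : ∀ T' ∈ Set.Ioo 0 T, ∃ P : ℝ → EuclideanSpace ℝ (Fin 3) → ℝ, IsTaoSolutionOn T' ν (u 0) u P :=
    stub_taoRep ν T hν hT u p hcl hLH hdec
  obtain ⟨cP, K, hcP, hK, hpers⟩ := stub_enstrophyPersistence
  have hpers' := hpers ν T hν hT u p hcl hrep
  obtain ⟨C, hC⟩ := stub_zoomBound
  obtain ⟨C₁, H, κ, hκ, hC1k⟩ := stub_zoomC1kappa stub_oseenC1kappa C hC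
  have hC1k' := hC1k ν T hν hT u p hcl hLH hdec hrep
  obtain ⟨tc, xc, L, s₀, θ, hs₀, hθ, htc, hL, hdom, hpast, hconc⟩ :=
    stub_enstrophyConcentrationBranch ν T hν hT u p hcl hLH hrep hnext cP K hcP hK hpers'
      C₁ H κ hκ hC1k' R ε hR hε hEC
  exact ⟨θ, hθ, exists_criticalVelocity_of_concentratedZooms hν hT hrep hs₀ hθ htc hL hdom hpast hconc⟩

end Summit.NavierStokesRegularity.NavierStokesRegularity.Theorems.RecordZoomAncient.Birth

end
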